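import Summits.CriticalPhenomena.PercolationContinuityZ3.Theorems.PercNearOneGluingNoHeavyLowerTailSahiThreeCopyLawBack

/-!
# `NoHeavyLowerTail` (crux stmt-CriticalPhenomena-4575), Sahi programme: **law-level back reduction, part 2** — splitting the whole-cube
# Bernstein expansion of `E₃` into front and back profiles, and `LawGood` at every front profile ⇒ `E₃^{coin Q}(frontFn f, G, H) ≥ 0`

Support file (Sahi cell, seat `prim-sahi-p1`, generation 64; `--supports stmt-CriticalPhenomena-4575`); continuation of `…SahiThreeCopyLawBack`
(split off for the 400-line limit).  `E₃^{coin Q}(F,G,H) = Σ_B m_B(Q) c_B(F,G,H)` (`sahiE_three_coinWeight`, gen 53) is regrouped as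
`Σ_π m_π(Q_front) Σ_b m_b(Q_back) c_{(π,b)}(F,G,H)` (`sum_bern3_split`, induction on the number `k` of front coordinates with `Fin.consEquiv` and
`Fin.prod_univ_succ`); hence (`sahiE_three_coin_frontFn_nonneg_of_lawGood`) a slot that is `LawGood` at every front profile satisfies Sahi's third
inequality at law level on the whole cube `{0,1}^{d+k}` for every coin weight `Q ∈ [0,1]^{d+k}` and all monotone `[0,1]`-valued `G, H`.  Pure
bookkeeping; no `sorry`, standard axioms; nothing conjectural is used or asserted. [this work]
-/

namespace Summit.CriticalPhenomena.PercolationContinuityZ3.Theorems.SahiThreeCopy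

open Finset Function Literature.Combinatorics.Sahi2008
open scoped BigOperators

noncomputable section

variable {d : ℕ}

/-! ### §1 Splitting the whole-cube Bernstein expansion into front and back

`E₃^{coin Q}(frontFn f, G, H) = Σ_π m_π(Q_front) · Σ_b m_b(Q_back) · c_{(π,b)}(frontFn f, G, H)` — so `LawGood` at every front profile gives
Sahi's `E₃ ≥ 0` at law level on the whole cube `{0,1}^{d+k}` for every coin weight `Q ∈ [0,1]^{d+k}`. -/

/-- The FRONT part (first `k` coordinates) of a coin vector on `Fin (d+k)`. [this work] -/
def frontQ : (k : ℕ) → (Fin (d + k) → ℝ) → (Fin k → ℝ)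
  | 0, _ => fun i => Fin.elim0 i
  | k + 1, Q => Fin.cons (Q 0) (frontQ k (Fin.tail Q))

/-- The BACK part (last `d` coordinates) of a coin vector on `Fin (d+k)`. [this work] -/
def backQ : (k : ℕ) → (Fin (d + k) → ℝ) → (Fin d → ℝ)
  | 0, Q => Q
  | k + 1, Q => backQ k (Fin.tail Q)

/-- Entries of `frontQ` lie in `[0,1]` if those of `Q` do. [this work] -/
theorem frontQ_mem : ∀ (k : ℕ) {Q : Fin (d + k) → ℝ}, (∀ i, 0 ≤ Q i ∧ Q i ≤ 1) → ∀ i, 0 ≤ frontQ k Q i ∧ frontQ k Q i ≤ 1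
  | 0, _, _, i => Fin.elim0 i
  | k + 1, Q, hQ, i => by
    refine Fin.cases ?_ (fun j => ?_) i
    · simpa [frontQ] using hQ 0
    · simp only [frontQ, Fin.cons_succ]
      exact frontQ_mem k (fun i => hQ i.succ) j

/-- Entries of `backQ` lie in `[0,1]` if those of `Q` do. [this work] -/
theorem backQ_mem : ∀ (k : ℕ) {Q : Fin (d + k) → ℝ}, (∀ i, 0 ≤ Q i ∧ Q i ≤ 1) → ∀ i, 0 ≤ backQ k Q i ∧ backQ k Q i ≤ 1
  | 0, _, hQ, i => hQ i
  | k + 1, _, hQ, i => backQ_mem k (fun i => hQ i.succ) i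

/-- Peeling coordinate `0` off a Bernstein monomial. [this work] -/
theorem bern3_succ {n : ℕ} (q : Fin (n + 1) → ℝ) (b : Fin (n + 1) → ℕ) :
    bern3 q b = q 0 ^ b 0 * (1 - q 0) ^ (3 - b 0) * bern3 (Fin.tail q) (Fin.tail b) := by
  unfold bern3
  rw [Fin.prod_univ_succ]
  rfl

/-- Splitting a sum over `Fin (n+1) → Fin 4` along coordinate `0`. [folklore] -/
theorem sum_prof_succ {n : ℕ} (F : (Fin (n + 1) → Fin 4) → ℝ) :
    ∑ B : Fin (n + 1) → Fin 4, F B = ∑ a : Fin 4, ∑ B' : Fin n → Fin 4, F (Fin.cons a B') := by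
  rw [← Fintype.sum_equiv (Fin.consEquiv fun _ : Fin (n + 1) => Fin 4) (fun p => F (Fin.cons p.1 p.2)) F
    (fun p => rfl), Fintype.sum_prod_type]

/-- `sum_prof_succ` at the index type `Fin (d + (k+1))` (syntactic form used below). [folklore] -/
theorem sum_prof_succ' (k : ℕ) (F : (Fin (d + (k + 1)) → Fin 4) → ℝ) :
    ∑ B : Fin (d + (k + 1)) → Fin 4, F B = ∑ a : Fin 4, ∑ B' : Fin (d + k) → Fin 4, F (Fin.cons a B') :=
  sum_prof_succ (n := d + k) F

/-- Coercion to `ℕ` commutes with `Fin.cons` on profiles. [this work] -/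
theorem coe_cons_prof {n : ℕ} (a : Fin 4) (B' : Fin n → Fin 4) :
    (fun i : Fin (n + 1) => ((Fin.cons (α := fun _ => Fin 4) a B' i : Fin 4) : ℕ)) =
      Fin.cons (α := fun _ => ℕ) (a : ℕ) (fun i => ((B' i : Fin 4) : ℕ)) := by
  funext i
  refine Fin.cases ?_ (fun j => ?_) i
  · simp
  · simp

/-- ★ **Front/back split of a Bernstein-weighted sum over all profiles of `{0,1}^{d+k}`**: for any `X` on profiles,
`Σ_B m_B(Q) X(B) = Σ_π Σ_b m_π(Q_front) m_b(Q_back) X(appendProf π b)`. [this work] -/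
theorem sum_bern3_split : ∀ (k : ℕ) (Q : Fin (d + k) → ℝ) (X : (Fin (d + k) → ℕ) → ℝ),
    ∑ B : Fin (d + k) → Fin 4, bern3 Q (fun i => ((B i : Fin 4) : ℕ)) * X (fun i => ((B i : Fin 4) : ℕ)) =
      ∑ π : Fin k → Fin 4, ∑ b : Fin d → Fin 4, bern3 (frontQ k Q) (fun i => ((π i : Fin 4) : ℕ)) *
        (bern3 (backQ k Q) (fun i => ((b i : Fin 4) : ℕ)) * X (appendProf k (fun i => ((π i : Fin 4) : ℕ)) (fun i => ((b i : Fin 4) : ℕ))))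
  | 0, Q, X => by
    symm
    rw [Fintype.sum_unique]
    refine sum_congr rfl fun b _ => ?_
    have h1 : ∀ π : Fin 0 → Fin 4, bern3 (frontQ (d := d) 0 Q) (fun i => ((π i : Fin 4) : ℕ)) = 1 :=
      fun π => Fintype.prod_empty _
    rw [h1, one_mul]
    rfl
  | k + 1, Q, X => by
    rw [sum_prof_succ' k]
    conv_rhs => rw [sum_prof_succ]
    refine sum_congr rfl fun a _ => ?_
    -- inner: apply the induction hypothesis to the tail with the shifted `X`
    have IH := sum_bern3_split k (Fin.tail Q) (fun B' => X (Fin.cons (a : ℕ) B'))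
    have lhs : ∀ B' : Fin (d + k) → Fin 4,
        bern3 Q (fun i => (((Fin.cons a B' : Fin (d + (k + 1)) → Fin 4) i : Fin 4) : ℕ)) *
          X (fun i => (((Fin.cons a B' : Fin (d + (k + 1)) → Fin 4) i : Fin 4) : ℕ)) =
        (Q 0 ^ (a : ℕ) * (1 - Q 0) ^ (3 - (a : ℕ))) *
          (bern3 (Fin.tail Q) (fun i => ((B' i : Fin 4) : ℕ)) * X (Fin.cons (a : ℕ) (fun i => ((B' i : Fin 4) : ℕ)))) := by
      intro B'
      have hc := coe_cons_prof (n := d + k) a B'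
      have step := congrArg (fun φ : Fin (d + k + 1) → ℕ => bern3 Q φ * X φ) hc
      refine step.trans ?_
      rw [bern3_succ, Fin.cons_zero, Fin.tail_cons, mul_assoc]
      rfl
    have rhs : ∀ (π' : Fin k → Fin 4) (b : Fin d → Fin 4),
        bern3 (frontQ (k + 1) Q) (fun i => (((Fin.cons a π' : Fin (k + 1) → Fin 4) i : Fin 4) : ℕ)) *
          (bern3 (backQ (k + 1) Q) (fun i => ((b i : Fin 4) : ℕ)) *
            X (appendProf (k + 1) (fun i => (((Fin.cons a π' : Fin (k + 1) → Fin 4) i : Fin 4) : ℕ)) (fun i => ((b i : Fin 4) : ℕ)))) =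
        (Q 0 ^ (a : ℕ) * (1 - Q 0) ^ (3 - (a : ℕ))) *
          (bern3 (frontQ k (Fin.tail Q)) (fun i => ((π' i : Fin 4) : ℕ)) *
            (bern3 (backQ k (Fin.tail Q)) (fun i => ((b i : Fin 4) : ℕ)) *
              X (Fin.cons (a : ℕ) (appendProf k (fun i => ((π' i : Fin 4) : ℕ)) (fun i => ((b i : Fin 4) : ℕ)))))) := by
      intro π' b
      have hc := coe_cons_prof (n := k) a π'
      have step := congrArg (fun φ : Fin (k + 1) → ℕ => bern3 (frontQ (k + 1) Q) φ *
        (bern3 (backQ (k + 1) Q) (fun i => ((b i : Fin 4) : ℕ)) * X (appendProf (k + 1) φ (fun i => ((b i : Fin 4) : ℕ))))) hc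
      refine step.trans ?_
      have hf : frontQ (d := d) (k + 1) Q = Fin.cons (Q 0) (frontQ k (Fin.tail Q)) := rfl
      have hb : backQ (d := d) (k + 1) Q = backQ k (Fin.tail Q) := rfl
      have ha : appendProf (d := d) (k + 1) (Fin.cons (a : ℕ) (fun i => ((π' i : Fin 4) : ℕ))) (fun i => ((b i : Fin 4) : ℕ)) =
          Fin.cons (a : ℕ) (appendProf k (fun i => ((π' i : Fin 4) : ℕ)) (fun i => ((b i : Fin 4) : ℕ))) := by
        rw [appendProf_succ, Fin.cons_zero, Fin.tail_cons]
      rw [hf, hb, ha, bern3_succ, Fin.cons_zero, Fin.tail_cons, Fin.cons_zero, Fin.tail_cons]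
      ring
    calc ∑ B' : Fin (d + k) → Fin 4, bern3 Q (fun i => (((Fin.cons (α := fun _ => Fin 4) a B') i : Fin 4) : ℕ)) *
            X (fun i => (((Fin.cons (α := fun _ => Fin 4) a B') i : Fin 4) : ℕ))
        = ∑ B' : Fin (d + k) → Fin 4, (Q 0 ^ (a : ℕ) * (1 - Q 0) ^ (3 - (a : ℕ))) *
            (bern3 (Fin.tail Q) (fun i => ((B' i : Fin 4) : ℕ)) * X (Fin.cons (a : ℕ) (fun i => ((B' i : Fin 4) : ℕ)))) :=
          sum_congr rfl fun B' _ => lhs B'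
      _ = (Q 0 ^ (a : ℕ) * (1 - Q 0) ^ (3 - (a : ℕ))) * ∑ π' : Fin k → Fin 4, ∑ b : Fin d → Fin 4,
            bern3 (frontQ k (Fin.tail Q)) (fun i => ((π' i : Fin 4) : ℕ)) *
              (bern3 (backQ k (Fin.tail Q)) (fun i => ((b i : Fin 4) : ℕ)) *
                X (Fin.cons (a : ℕ) (appendProf k (fun i => ((π' i : Fin 4) : ℕ)) (fun i => ((b i : Fin 4) : ℕ))))) := by
          rw [← mul_sum]
          exact congrArg _ IH
      _ = _ := by
          rw [mul_sum]
          refine sum_congr rfl fun π' _ => ?_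
          rw [mul_sum]
          exact sum_congr rfl fun b _ => (rhs π' b).symm

/-- ★★ **LAW-LEVEL `E₃ ≥ 0` FROM `LawGood` AT EVERY FRONT PROFILE.**  If the slot `f` on `k` front coordinates is `LawGood` at every front profile, then
for every back dimension `d`, every coin weight `Q ∈ [0,1]^{d+k}` on the whole cube and all monotone `[0,1]`-valued `G, H`:
`0 ≤ E₃^{coin Q}(frontFn f, G, H)` — Sahi's third inequality at law level for the free slot against two arbitrary slots. [this work] -/
theorem sahiE_three_coin_frontFn_nonneg_of_lawGood {k : ℕ} {f : Pt k → ℝ} (hgood : ∀ π : Fin k → ℕ, LawGood k π f)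
    {Q : Fin (d + k) → ℝ} (hQ : ∀ i, 0 ≤ Q i ∧ Q i ≤ 1) {G H : Pt (d + k) → ℝ} (hG : ∀ w, 0 ≤ G w) (hG1 : ∀ w, G w ≤ 1)
    (hH : ∀ w, 0 ≤ H w) (hH1 : ∀ w, H w ≤ 1) (hGm : Monotone G) (hHm : Monotone H) :
    0 ≤ sahiE (coinWeight Q) 3 ![frontFn k f, G, H] := by
  rw [sahiE_three_coinWeight, sum_bern3_split k Q (fun B => tc B (frontFn k f) G H)]
  refine sum_nonneg fun π _ => ?_
  rw [← mul_sum]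
  exact mul_nonneg (bern3_nonneg (frontQ_mem k hQ) _) (hgood _ (backQ k Q) (backQ_mem k hQ) hG hG1 hH hH1 hGm hHm)

/-! ### §2 Pointwise (pair-dependent) two-point certificates (gen 64, memo §3(d): "piecewise TP₀") -/

/-- ★ **Pair-dependent two-point certificates give `(L*)`.**  If for EVERY admissible triple `(φ, ψ, κ)` (nonnegative monotone `φ, ψ`, monotone
`κ ≥ φψ`) there is SOME weight `θ ≥ 0` (allowed to depend on the triple) with gen 59's (N1) for `(κ, 1)` and (N2) for `(φ, ψ)`, then `(f, π)` has
the pointwise two-point property — hence (`lawGood_of_pointwiseTP`) is `LawGood`.  This is the formal target of CELL CERTIFICATES (one `θ` per cell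
of a finite cover of the monotone pairs); gen 59's TP₀ is the special case of a constant `θ`. [this work] -/
theorem pointwiseTP_of_pointwise_twoPoint (k : ℕ) (π : Fin k → ℕ) (f : Pt k → ℝ)
    (h : ∀ φ ψ κ : Pt k → ℝ, (∀ e, 0 ≤ φ e) → (∀ e, 0 ≤ ψ e) → Monotone φ → Monotone ψ → Monotone κ → (∀ e, φ e * ψ e ≤ κ e) →
      ∃ θ : Pt k → Pt k → Pt k → ℝ, (∀ e₁ e₂ e₃, 0 ≤ θ e₁ e₂ e₃) ∧
        0 ≤ ∑ σ : Pt k × Pt k × Pt k, arrInd π σ.1 σ.2.1 σ.2.2 *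
          ((2 * f σ.1 - θ σ.1 σ.2.1 σ.2.2) * (κ σ.1 * (1 : Pt k → ℝ) σ.1) - f σ.1 * (κ σ.2.1 * (1 : Pt k → ℝ) σ.2.1)) ∧
        0 ≤ ∑ σ : Pt k × Pt k × Pt k, arrInd π σ.1 σ.2.1 σ.2.2 *
          (θ σ.1 σ.2.1 σ.2.2 * (φ σ.1 * ψ σ.1) + f σ.1 * (φ σ.2.1 * ψ σ.2.2)
            - f σ.2.1 * (φ σ.1 * ψ σ.2.1) - f σ.2.1 * (φ σ.2.1 * ψ σ.1))) :
    PointwiseTP k π f := by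
  intro φ ψ κ hφ hψ hφm hψm hκm hκ
  obtain ⟨θ, hθ, e1, e2⟩ := h φ ψ κ hφ hψ hφm hψm hκm hκ
  have e3 : 0 ≤ ∑ σ : Pt k × Pt k × Pt k, arrInd π σ.1 σ.2.1 σ.2.2 * (θ σ.1 σ.2.1 σ.2.2 * (κ σ.1 - φ σ.1 * ψ σ.1)) :=
    sum_nonneg fun σ _ => mul_nonneg (arrInd_nonneg π _ _ _) (mul_nonneg (hθ _ _ _) (sub_nonneg.2 (hκ _)))
  rw [lawPsi_eq_sum_triple]
  have key : ∑ σ : Pt k × Pt k × Pt k, arrInd π σ.1 σ.2.1 σ.2.2 *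
      (2 * f σ.1 * κ σ.1 - f σ.1 * κ σ.2.1 - f σ.2.1 * (φ σ.1 * ψ σ.2.1) - f σ.2.1 * (ψ σ.1 * φ σ.2.1) + f σ.1 * (φ σ.2.1 * ψ σ.2.2)) =
      (∑ σ : Pt k × Pt k × Pt k, arrInd π σ.1 σ.2.1 σ.2.2 *
        ((2 * f σ.1 - θ σ.1 σ.2.1 σ.2.2) * (κ σ.1 * (1 : Pt k → ℝ) σ.1) - f σ.1 * (κ σ.2.1 * (1 : Pt k → ℝ) σ.2.1))) +
      (∑ σ : Pt k × Pt k × Pt k, arrInd π σ.1 σ.2.1 σ.2.2 *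
        (θ σ.1 σ.2.1 σ.2.2 * (φ σ.1 * ψ σ.1) + f σ.1 * (φ σ.2.1 * ψ σ.2.2)
          - f σ.2.1 * (φ σ.1 * ψ σ.2.1) - f σ.2.1 * (φ σ.2.1 * ψ σ.1))) +
      ∑ σ : Pt k × Pt k × Pt k, arrInd π σ.1 σ.2.1 σ.2.2 * (θ σ.1 σ.2.1 σ.2.2 * (κ σ.1 - φ σ.1 * ψ σ.1)) := by
    rw [← sum_add_distrib, ← sum_add_distrib]
    refine sum_congr rfl fun σ _ => ?_
    simp only [Pi.one_apply]
    ring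
  rw [key]
  exact add_nonneg (add_nonneg e1 e2) e3

/-- ★ **Piecewise TP₀ by scores (cell certificates).**  Let `ℓ : Fin M → (Pt k → ℝ)` be finitely many linear SCORES (`M ≥ 1`).  Suppose that for
every ordered pair of cells `(p, q)` there is a weight `θ_{pq} ≥ 0` such that (N1) holds for all nonnegative monotone `κ` and (N2) holds for all
nonnegative monotone `(φ, ψ)` with `φ` in cell `p` (`⟨ℓ_p − ℓ_j, φ⟩ ≥ 0 ∀ j`) and `ψ` in cell `q`.  Since every `φ` lies in the cell of a maximal
score, `(f, π)` has the pointwise two-point property. [this work] -/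
theorem pointwiseTP_of_cells (k : ℕ) (π : Fin k → ℕ) (f : Pt k → ℝ) {M : ℕ} (hM : 0 < M) (ℓ : Fin M → Pt k → ℝ)
    (θ : Fin M → Fin M → Pt k → Pt k → Pt k → ℝ) (hθ : ∀ p q e₁ e₂ e₃, 0 ≤ θ p q e₁ e₂ e₃)
    (hN1 : ∀ (p q : Fin M) (κ : Pt k → ℝ), (∀ e, 0 ≤ κ e) → Monotone κ →
      0 ≤ ∑ σ : Pt k × Pt k × Pt k, arrInd π σ.1 σ.2.1 σ.2.2 *
        ((2 * f σ.1 - θ p q σ.1 σ.2.1 σ.2.2) * (κ σ.1 * (1 : Pt k → ℝ) σ.1) - f σ.1 * (κ σ.2.1 * (1 : Pt k → ℝ) σ.2.1)))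
    (hN2 : ∀ (p q : Fin M) (φ ψ : Pt k → ℝ), (∀ e, 0 ≤ φ e) → (∀ e, 0 ≤ ψ e) → Monotone φ → Monotone ψ →
      (∀ j, ∑ e, (ℓ j e) * φ e ≤ ∑ e, (ℓ p e) * φ e) → (∀ j, ∑ e, (ℓ j e) * ψ e ≤ ∑ e, (ℓ q e) * ψ e) →
      0 ≤ ∑ σ : Pt k × Pt k × Pt k, arrInd π σ.1 σ.2.1 σ.2.2 *
        (θ p q σ.1 σ.2.1 σ.2.2 * (φ σ.1 * ψ σ.1) + f σ.1 * (φ σ.2.1 * ψ σ.2.2)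
          - f σ.2.1 * (φ σ.1 * ψ σ.2.1) - f σ.2.1 * (φ σ.2.1 * ψ σ.1))) :
    PointwiseTP k π f := by
  refine pointwiseTP_of_pointwise_twoPoint k π f fun φ ψ κ hφ hψ hφm hψm hκm hκ => ?_
  haveI : Nonempty (Fin M) := ⟨⟨0, hM⟩⟩
  obtain ⟨p, hp⟩ := Finite.exists_max fun j : Fin M => ∑ e, ℓ j e * φ e
  obtain ⟨q, hq⟩ := Finite.exists_max fun j : Fin M => ∑ e, ℓ j e * ψ e
  have hκ0 : ∀ e, 0 ≤ κ e := fun e => (mul_nonneg (hφ e) (hψ e)).trans (hκ e)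
  exact ⟨θ p q, hθ p q, hN1 p q κ hκ0 hκm, hN2 p q φ ψ hφ hψ hφm hψm hp hq⟩

end

end Summit.CriticalPhenomena.PercolationContinuityZ3.Theorems.SahiThreeCopy
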